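import Summits.QuantumFields.YangMills.Theorems.ColdStartUniversalityShenZhuZhuRiemannDistTriangleSU2
import HarnessLib

/-!
# The QUATERNIONIC RETRACTION onto `SU(2)` and its metric distortion: `π(M) = √2·𝖯M/|𝖯M|` (`𝖯` the orthogonal projection of `M₂(ℂ)` onto the
# quaternion plane `ℍ = span_ℝ SU(2)`), `π(q) = q` on the group, and `chord(π M, π M') ≤ (√2/m)·|M − M'|` whenever `|𝖯M|, |𝖯M'| ≥ m`

Seat `ym-line-csu-p1` (g41), route `ColdStartUniversality` of `Summits/QuantumFields/YangMills`, helper file G50 (`--supports stmt-QuantumFields-24809`).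
First brick of the extension of the `ρ_L`-Lipschitz contraction (G44) from `C⁵` cylinder functions to ALL Lipschitz functions on `SU(2)^E`: a Lipschitz
function on the group is extended to the ambient coordinate space through the retraction `π` and then mollified; this file controls how much `π`
distorts distances near the group.

* `quatProj` facts (stated with the explicit matrix `𝖯M = [[(M₀₀ + M̄₁₁)/2, (M₀₁ − M̄₁₀)/2], [−conj(M₀₁ − M̄₁₀)/2, conj(M₀₀ + M̄₁₁)/2]]`, no definition):
  `hsForm_quatProj_le` (`|𝖯M|² ≤ |M|²`), `quatProj_sub`, `quatProj_coe_two` (`𝖯q = q` on `SU(2)`);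
* ★ `normalize_mem_specialUnitaryGroup_two` — `√2·𝖯M/|𝖯M| ∈ SU(2)` for `𝖯M ≠ 0` (a quaternion on the sphere `|·|² = 2` is special unitary);
* ★ `hsForm_normalize_sub_normalize_le` — the Dunkl–Williams-type inequality `|a/|a| − b/|b||² ≤ |a − b|²/(|a||b|)` in `(M₂(ℂ), Re tr(XYᴴ))`;
* ★★ `chord_retraction_le` — for `|𝖯M|, |𝖯M'| ≥ m > 0`: `‖π M − π M'‖_F ≤ (√2/m)·‖M − M'‖_F`;
* ★★ `riemannDist_le_chord_div_sqrt` — arc versus chord at small scales on `SU(2)`: `ρ(g,h) ≤ c/√(1 − c²/8)`, `c = ‖h − g‖_F < 2√2`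
  (`θ/2 ≤ tan(θ/2)`), the local converse of G41's `chord ≤ arc`.

THEOREMS ONLY, no definition, no sorry.  HONEST FRAMING: elementary geometry of `SU(2) ⊂ M₂(ℂ)`; nothing about the dynamics or the route's scaling;
`UniformColdStartMixing` (24809, ASIDE) not restated; no crux, rung or summit statement is proved; the Yang–Mills mass gap is NOT proved.

References: S. Gallot, D. Hulin, J. Lafontaine, *Riemannian Geometry* (2004), 2.90–2.91 [GallotHulinLafontaine2004]; C. F. Dunkl, K. S. Williams,
*A simple norm inequality*, Amer. Math. Monthly 71 (1964) 53–54 (the inequality `|a/|a| − b/|b|| ≤ 2|a−b|/(|a|+|b|)`; here the weaker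
`≤ |a−b|/√(|a||b|)`, [folklore]).
-/

set_option autoImplicit false

noncomputable section

namespace Summit.QuantumFields.YangMills.Theorems.ColdStartUniversality

open Matrix Complex Finset
open scoped ComplexConjugate BigOperators Real
open Literature.MathematicalPhysics.QuantumFieldTheory
open Literature.MathematicalPhysics.QuantumLattice (fundamentalRep fundamentalLatticeRep fundamentalRep_apply fundamentalLatticeRep_N)

/-! ## §1. The quaternionic projection `𝖯` -/

/-- `|𝖯M|² = (|M₀₀ + M̄₁₁|² + |M₀₁ − M̄₁₀|²)/2` for the quaternionic projection
`𝖯M = [[(M₀₀ + M̄₁₁)/2, (M₀₁ − M̄₁₀)/2], [−conj((M₀₁ − M̄₁₀)/2), conj((M₀₀ + M̄₁₁)/2)]]`. [folklore] -/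
theorem hsForm_quatProj_self (M : Matrix (Fin 2) (Fin 2) ℂ) :
    hsForm 2 (!![(M 0 0 + conj (M 1 1)) / 2, (M 0 1 - conj (M 1 0)) / 2; -conj ((M 0 1 - conj (M 1 0)) / 2), conj ((M 0 0 + conj (M 1 1)) / 2)])
      (!![(M 0 0 + conj (M 1 1)) / 2, (M 0 1 - conj (M 1 0)) / 2; -conj ((M 0 1 - conj (M 1 0)) / 2), conj ((M 0 0 + conj (M 1 1)) / 2)]) =
      (‖M 0 0 + conj (M 1 1)‖ ^ 2 + ‖M 0 1 - conj (M 1 0)‖ ^ 2) / 2 := by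
  rw [hsForm_self_quaternion (by simp) (by simp)]
  simp only [Matrix.of_apply, Matrix.cons_val', Matrix.cons_val_zero, Matrix.cons_val_one, Matrix.cons_val_fin_one, norm_div,
    Complex.norm_ofNat]
  ring

/-- ★ **`|𝖯M|² ≤ |M|²`**: the quaternionic projection does not increase the Hilbert–Schmidt norm (`|a + b̄|² ≤ 2|a|² + 2|b|²`). [folklore] -/
theorem hsForm_quatProj_le (M : Matrix (Fin 2) (Fin 2) ℂ) :
    hsForm 2 (!![(M 0 0 + conj (M 1 1)) / 2, (M 0 1 - conj (M 1 0)) / 2; -conj ((M 0 1 - conj (M 1 0)) / 2), conj ((M 0 0 + conj (M 1 1)) / 2)])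
      (!![(M 0 0 + conj (M 1 1)) / 2, (M 0 1 - conj (M 1 0)) / 2; -conj ((M 0 1 - conj (M 1 0)) / 2), conj ((M 0 0 + conj (M 1 1)) / 2)]) ≤
      hsForm 2 M M := by
  rw [hsForm_quatProj_self, hsForm_self]
  simp only [Fin.sum_univ_two]
  have h1 : ‖M 0 0 + conj (M 1 1)‖ ^ 2 ≤ 2 * ‖M 0 0‖ ^ 2 + 2 * ‖M 1 1‖ ^ 2 := by
    have h := norm_add_le (M 0 0) (conj (M 1 1))
    rw [Complex.norm_conj] at h
    have h' : ‖M 0 0 + conj (M 1 1)‖ ^ 2 ≤ (‖M 0 0‖ + ‖M 1 1‖) ^ 2 := pow_le_pow_left₀ (norm_nonneg _) h 2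
    nlinarith [sq_nonneg (‖M 0 0‖ - ‖M 1 1‖)]
  have h2 : ‖M 0 1 - conj (M 1 0)‖ ^ 2 ≤ 2 * ‖M 0 1‖ ^ 2 + 2 * ‖M 1 0‖ ^ 2 := by
    have h := norm_sub_le (M 0 1) (conj (M 1 0))
    rw [Complex.norm_conj] at h
    have h' : ‖M 0 1 - conj (M 1 0)‖ ^ 2 ≤ (‖M 0 1‖ + ‖M 1 0‖) ^ 2 := pow_le_pow_left₀ (norm_nonneg _) h 2
    nlinarith [sq_nonneg (‖M 0 1‖ - ‖M 1 0‖)]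
  linarith

/-- `𝖯` is additive: `𝖯M − 𝖯M' = 𝖯(M − M')`. [folklore] -/
theorem quatProj_sub (M M' : Matrix (Fin 2) (Fin 2) ℂ) :
    (!![(M 0 0 + conj (M 1 1)) / 2, (M 0 1 - conj (M 1 0)) / 2; -conj ((M 0 1 - conj (M 1 0)) / 2), conj ((M 0 0 + conj (M 1 1)) / 2)] : Matrix (Fin 2) (Fin 2) ℂ) -
      !![(M' 0 0 + conj (M' 1 1)) / 2, (M' 0 1 - conj (M' 1 0)) / 2; -conj ((M' 0 1 - conj (M' 1 0)) / 2), conj ((M' 0 0 + conj (M' 1 1)) / 2)] =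
      !![((M - M') 0 0 + conj ((M - M') 1 1)) / 2, ((M - M') 0 1 - conj ((M - M') 1 0)) / 2;
        -conj (((M - M') 0 1 - conj ((M - M') 1 0)) / 2), conj (((M - M') 0 0 + conj ((M - M') 1 1)) / 2)] := by
  ext i j
  fin_cases i <;> fin_cases j <;> simp [Matrix.sub_apply, map_sub] <;> ring

/-- ★ **`𝖯q = q` on `SU(2)`** (an `SU(2)` matrix is a quaternion `[[z, w], [−w̄, z̄]]`). [folklore] -/
theorem quatProj_coe_two (q : Matrix.specialUnitaryGroup (Fin 2) ℂ) :
    (!![((q : Matrix (Fin 2) (Fin 2) ℂ) 0 0 + conj ((q : Matrix (Fin 2) (Fin 2) ℂ) 1 1)) / 2,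
        ((q : Matrix (Fin 2) (Fin 2) ℂ) 0 1 - conj ((q : Matrix (Fin 2) (Fin 2) ℂ) 1 0)) / 2;
        -conj ((((q : Matrix (Fin 2) (Fin 2) ℂ) 0 1 - conj ((q : Matrix (Fin 2) (Fin 2) ℂ) 1 0)) / 2)),
        conj ((((q : Matrix (Fin 2) (Fin 2) ℂ) 0 0 + conj ((q : Matrix (Fin 2) (Fin 2) ℂ) 1 1)) / 2))] : Matrix (Fin 2) (Fin 2) ℂ) =
      (q : Matrix (Fin 2) (Fin 2) ℂ) := by
  have h11 := apply_one_one_eq q.2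
  have h10 := apply_one_zero_eq q.2
  ext i j
  fin_cases i <;> fin_cases j
  · simp [h11]
  · simp [h10]
  · simp [h10]
  · simp [h11]

/-! ## §2. Normalisation: the sphere `|·|² = 2` in the quaternion plane is `SU(2)` -/

/-- ★ **`√2·𝖯M/|𝖯M| ∈ SU(2)`** whenever `𝖯M ≠ 0`. [folklore] -/
theorem normalize_quatProj_mem_specialUnitaryGroup_two (M : Matrix (Fin 2) (Fin 2) ℂ)
    (hM : hsForm 2 (!![(M 0 0 + conj (M 1 1)) / 2, (M 0 1 - conj (M 1 0)) / 2; -conj ((M 0 1 - conj (M 1 0)) / 2), conj ((M 0 0 + conj (M 1 1)) / 2)])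
      (!![(M 0 0 + conj (M 1 1)) / 2, (M 0 1 - conj (M 1 0)) / 2; -conj ((M 0 1 - conj (M 1 0)) / 2), conj ((M 0 0 + conj (M 1 1)) / 2)]) ≠ 0) :
    ((Real.sqrt 2 / Real.sqrt (hsForm 2 (!![(M 0 0 + conj (M 1 1)) / 2, (M 0 1 - conj (M 1 0)) / 2; -conj ((M 0 1 - conj (M 1 0)) / 2), conj ((M 0 0 + conj (M 1 1)) / 2)])
      (!![(M 0 0 + conj (M 1 1)) / 2, (M 0 1 - conj (M 1 0)) / 2; -conj ((M 0 1 - conj (M 1 0)) / 2), conj ((M 0 0 + conj (M 1 1)) / 2)])) : ℝ) •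
        (!![(M 0 0 + conj (M 1 1)) / 2, (M 0 1 - conj (M 1 0)) / 2; -conj ((M 0 1 - conj (M 1 0)) / 2), conj ((M 0 0 + conj (M 1 1)) / 2)] : Matrix (Fin 2) (Fin 2) ℂ))
      ∈ Matrix.specialUnitaryGroup (Fin 2) ℂ := by
  set P : Matrix (Fin 2) (Fin 2) ℂ := !![(M 0 0 + conj (M 1 1)) / 2, (M 0 1 - conj (M 1 0)) / 2; -conj ((M 0 1 - conj (M 1 0)) / 2), conj ((M 0 0 + conj (M 1 1)) / 2)] with hP
  set s : ℝ := hsForm 2 P P with hs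
  have hs0 : 0 < s := lt_of_le_of_ne (hsForm_self_nonneg P) (Ne.symm hM)
  set c : ℝ := Real.sqrt 2 / Real.sqrt s with hc
  refine mem_specialUnitaryGroup_of_quaternion ?_ ?_ ?_
  · simp [hP, Matrix.smul_apply, Complex.real_smul]
  · simp [hP, Matrix.smul_apply, Complex.real_smul]
  · rw [hsForm_real_smul_left, hsForm_comm, hsForm_real_smul_left, ← hs]
    have hcc : c * c = 2 / s := by
      rw [hc, div_mul_div_comm, Real.mul_self_sqrt (by norm_num : (0:ℝ) ≤ 2), Real.mul_self_sqrt hs0.le]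
    calc c * (c * s) = (c * c) * s := by ring
      _ = 2 := by rw [hcc, div_mul_cancel₀ _ hs0.ne']

/-! ## §3. The radial-projection inequality in `(M₂(ℂ), Re tr(XYᴴ))` -/

/-- ★ **`|a/|a| − b/|b||² ≤ |a − b|²/(|a|·|b|)`** for `a, b ≠ 0` in the real Hilbert space `(M₂(ℂ), Re tr(XYᴴ))`
(`|a||b|·|â − b̂|² = |a−b|² − (|a| − |b|)²`). [folklore] -/
theorem hsForm_normalize_sub_normalize_le {N : ℕ} (a b : Matrix (Fin N) (Fin N) ℂ) (ha : hsForm N a a ≠ 0) (hb : hsForm N b b ≠ 0) :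
    hsForm N (((1 / Real.sqrt (hsForm N a a) : ℝ)) • a - ((1 / Real.sqrt (hsForm N b b) : ℝ)) • b)
        (((1 / Real.sqrt (hsForm N a a) : ℝ)) • a - ((1 / Real.sqrt (hsForm N b b) : ℝ)) • b) ≤
      hsForm N (a - b) (a - b) / (Real.sqrt (hsForm N a a) * Real.sqrt (hsForm N b b)) := by
  set A : ℝ := Real.sqrt (hsForm N a a) with hA
  set B : ℝ := Real.sqrt (hsForm N b b) with hB
  have hA0 : 0 < A := Real.sqrt_pos.2 (lt_of_le_of_ne (hsForm_self_nonneg a) (Ne.symm ha))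
  have hB0 : 0 < B := Real.sqrt_pos.2 (lt_of_le_of_ne (hsForm_self_nonneg b) (Ne.symm hb))
  have haa : hsForm N a a = A ^ 2 := by rw [hA, Real.sq_sqrt (hsForm_self_nonneg a)]
  have hbb : hsForm N b b = B ^ 2 := by rw [hB, Real.sq_sqrt (hsForm_self_nonneg b)]
  set p : ℝ := hsForm N a b with hp
  have hba : hsForm N b a = p := by rw [hsForm_comm]
  -- expand both sides bilinearly
  have hL : hsForm N (((1 / A : ℝ)) • a - ((1 / B : ℝ)) • b) (((1 / A : ℝ)) • a - ((1 / B : ℝ)) • b) = 2 - 2 * p / (A * B) := by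
    simp only [map_sub, LinearMap.sub_apply, hsForm_real_smul_left]
    rw [hsForm_comm a (((1 / B : ℝ)) • b), hsForm_comm b (((1 / A : ℝ)) • a), hsForm_comm b (((1 / B : ℝ)) • b), hsForm_comm a (((1 / A : ℝ)) • a)]
    simp only [hsForm_real_smul_left, haa, hbb, hba, ← hp]
    field_simp
    ring
  have hR : hsForm N (a - b) (a - b) = A ^ 2 - 2 * p + B ^ 2 := by
    simp only [map_sub, LinearMap.sub_apply, haa, hbb, hba, ← hp]; ring
  rw [hL, hR, le_div_iff₀ (mul_pos hA0 hB0)]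
  have e : (2 - 2 * p / (A * B)) * (A * B) = 2 * A * B - 2 * p := by field_simp
  rw [e]
  nlinarith [sq_nonneg (A - B)]

/-- ★★ **Chord distortion of the radial projection**: for `a, b` with `|a|, |b| ≥ m > 0` and the normalisations `â = R·a/|a|`, `b̂ = R·b/|b|`
(`R ≥ 0`): `|â − b̂|² ≤ (R/m)²·|a − b|²`. [folklore] -/
theorem hsForm_radial_sub_radial_le {N : ℕ} (a b : Matrix (Fin N) (Fin N) ℂ) {m R : ℝ} (hm : 0 < m) (hR : 0 ≤ R)
    (ha : m ≤ Real.sqrt (hsForm N a a)) (hb : m ≤ Real.sqrt (hsForm N b b)) :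
    hsForm N (((R / Real.sqrt (hsForm N a a) : ℝ)) • a - ((R / Real.sqrt (hsForm N b b) : ℝ)) • b)
        (((R / Real.sqrt (hsForm N a a) : ℝ)) • a - ((R / Real.sqrt (hsForm N b b) : ℝ)) • b) ≤
      (R / m) ^ 2 * hsForm N (a - b) (a - b) := by
  have hA0 : 0 < Real.sqrt (hsForm N a a) := lt_of_lt_of_le hm ha
  have hB0 : 0 < Real.sqrt (hsForm N b b) := lt_of_lt_of_le hm hb
  have ha' : hsForm N a a ≠ 0 := fun h => by rw [h, Real.sqrt_zero] at hA0; exact lt_irrefl _ hA0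
  have hb' : hsForm N b b ≠ 0 := fun h => by rw [h, Real.sqrt_zero] at hB0; exact lt_irrefl _ hB0
  have key := hsForm_normalize_sub_normalize_le a b ha' hb'
  -- `R•(â₁ − b̂₁)` where `â₁ = a/|a|`
  have hscale : ((R / Real.sqrt (hsForm N a a) : ℝ)) • a - ((R / Real.sqrt (hsForm N b b) : ℝ)) • b =
      R • ((((1 / Real.sqrt (hsForm N a a) : ℝ)) • a - ((1 / Real.sqrt (hsForm N b b) : ℝ)) • b)) := by
    rw [smul_sub, smul_smul, smul_smul]; congr 1 <;> [skip; skip] <;> (congr 1; field_simp)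
  rw [hscale, hsForm_real_smul_left, hsForm_comm, hsForm_real_smul_left]
  have h0 : 0 ≤ hsForm N (a - b) (a - b) := hsForm_self_nonneg _
  calc R * (R * hsForm N (((1 / Real.sqrt (hsForm N a a) : ℝ)) • a - ((1 / Real.sqrt (hsForm N b b) : ℝ)) • b)
          (((1 / Real.sqrt (hsForm N a a) : ℝ)) • a - ((1 / Real.sqrt (hsForm N b b) : ℝ)) • b))
      ≤ R * (R * (hsForm N (a - b) (a - b) / (Real.sqrt (hsForm N a a) * Real.sqrt (hsForm N b b)))) :=
        mul_le_mul_of_nonneg_left (mul_le_mul_of_nonneg_left key hR) hR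
    _ ≤ R * (R * (hsForm N (a - b) (a - b) / (m * m))) := by
        refine mul_le_mul_of_nonneg_left (mul_le_mul_of_nonneg_left ?_ hR) hR
        exact div_le_div_of_nonneg_left h0 (mul_pos hm hm) (mul_le_mul ha hb hm.le hA0.le)
    _ = (R / m) ^ 2 * hsForm N (a - b) (a - b) := by field_simp

/-! ## §4. Arc versus chord at small scales on `SU(2)` -/

/-- ★★ **`ρ(g,h) ≤ c/√(1 − c²/8)`** for `g, h ∈ SU(2)` with chord `c = ‖h − g‖_F < 2√2`: the local converse of `‖h − g‖_F ≤ ρ(g,h)` (G41), from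
`c = 2√2·sin(θ/2)`, `ρ = √2·θ` and `θ/2 ≤ tan(θ/2)`.  In particular `ρ/c → 1` as `c → 0`. [cite: GallotHulinLafontaine2004, 2.91] -/
theorem riemannDist_two_le_chord_div_sqrt (g h : Matrix.specialUnitaryGroup (Fin 2) ℂ)
    (hc : hsForm 2 ((h : Matrix (Fin 2) (Fin 2) ℂ) - (g : Matrix (Fin 2) (Fin 2) ℂ)) ((h : Matrix (Fin 2) (Fin 2) ℂ) - (g : Matrix (Fin 2) (Fin 2) ℂ)) < 8) :
    (fundamentalLatticeRep 2).riemannDist g h ≤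
      Real.sqrt (hsForm 2 ((h : Matrix (Fin 2) (Fin 2) ℂ) - (g : Matrix (Fin 2) (Fin 2) ℂ)) ((h : Matrix (Fin 2) (Fin 2) ℂ) - (g : Matrix (Fin 2) (Fin 2) ℂ))) /
        Real.sqrt (1 - hsForm 2 ((h : Matrix (Fin 2) (Fin 2) ℂ) - (g : Matrix (Fin 2) (Fin 2) ℂ)) ((h : Matrix (Fin 2) (Fin 2) ℂ) - (g : Matrix (Fin 2) (Fin 2) ℂ)) / 8) := by
  set c2 : ℝ := hsForm 2 ((h : Matrix (Fin 2) (Fin 2) ℂ) - (g : Matrix (Fin 2) (Fin 2) ℂ)) ((h : Matrix (Fin 2) (Fin 2) ℂ) - (g : Matrix (Fin 2) (Fin 2) ℂ)) with hc2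
  set ρ : ℝ := (fundamentalLatticeRep 2).riemannDist g h with hρdef
  have hρ0 : 0 ≤ ρ := (fundamentalLatticeRep 2).riemannDist_nonneg g h
  have hρπ : ρ ≤ Real.sqrt 2 * Real.pi := riemannDist_two_le g h
  set θ : ℝ := ρ / Real.sqrt 2 with hθ
  have h2 : (0 : ℝ) < Real.sqrt 2 := Real.sqrt_pos.2 (by norm_num)
  have hρθ : ρ = Real.sqrt 2 * θ := by rw [hθ, mul_div_cancel₀ _ h2.ne']
  have hθ0 : 0 ≤ θ := div_nonneg hρ0 h2.le
  have hθπ : θ ≤ Real.pi := by rw [hθ, div_le_iff₀ h2]; linarith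
  -- `c² = 4(1 − cos θ) = 8 sin²(θ/2)`
  have hcos : c2 = 4 * (1 - Real.cos θ) := by rw [hc2, hsForm_sub_self_two_eq_cos]
  have hsin : c2 = 8 * Real.sin (θ / 2) ^ 2 := by
    rw [hcos]
    have := Real.sin_sq_eq_half_sub (θ / 2)
    rw [show 2 * (θ / 2) = θ by ring] at this
    rw [this]; ring
  have hs0 : 0 ≤ Real.sin (θ / 2) := Real.sin_nonneg_of_nonneg_of_le_pi (by linarith) (by linarith)
  have hsqrtc : Real.sqrt c2 = 2 * Real.sqrt 2 * Real.sin (θ / 2) := by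
    rw [hsin, show 8 * Real.sin (θ / 2) ^ 2 = (2 * Real.sqrt 2 * Real.sin (θ / 2)) ^ 2 by
      rw [mul_pow, mul_pow, Real.sq_sqrt (by norm_num : (0:ℝ) ≤ 2)]; ring, Real.sqrt_sq (by positivity)]
  -- `θ/2 < π/2`: from `c² < 8` we get `sin²(θ/2) < 1`, so `θ/2 ≠ π/2`
  have hlt : θ / 2 < Real.pi / 2 := by
    rcases (show θ / 2 ≤ Real.pi / 2 by linarith).lt_or_eq with hlt | heq
    · exact hlt
    · exfalso
      have : Real.sin (θ / 2) = 1 := by rw [heq, Real.sin_pi_div_two]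
      rw [hsin, this] at hc; norm_num at hc
  have hcos0 : 0 < Real.cos (θ / 2) := Real.cos_pos_of_mem_Ioo ⟨by linarith, hlt⟩
  -- `1 − c²/8 = cos²(θ/2)`
  have hden : 1 - c2 / 8 = Real.cos (θ / 2) ^ 2 := by
    rw [hsin]; nlinarith [Real.sin_sq_add_cos_sq (θ / 2)]
  have hsqrtden : Real.sqrt (1 - c2 / 8) = Real.cos (θ / 2) := by rw [hden, Real.sqrt_sq hcos0.le]
  rw [hsqrtc, hsqrtden, hρθ]
  -- `√2 θ ≤ 2√2 sin(θ/2)/cos(θ/2)` iff `θ/2 ≤ tan(θ/2)`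
  have htan := Real.le_tan (by linarith : 0 ≤ θ / 2) hlt
  rw [Real.tan_eq_sin_div_cos] at htan
  rw [le_div_iff₀ hcos0]
  have := mul_le_mul_of_nonneg_left ((le_div_iff₀ hcos0).1 htan) (by positivity : (0:ℝ) ≤ 2 * Real.sqrt 2)
  linarith

end Summit.QuantumFields.YangMills.Theorems.ColdStartUniversality

end
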